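import Summits.ResolutionOfSingularities.ResolutionOfSingularities.Theorems.DescentDescentPerfectToAllFieldFibreCore

/-!
# P2B `FieldFibreDescendsRegular` — PROVED (final composition)

Completes the proof of P2B from the core lemmas in `DescentDescentPerfectToAllFieldFibreCore`.
bears_on: LADDER-RESOLUTION:B · [OURS · CANDIDATE] counted 0; nothing here proves resolution
in char p.
-/

set_option linter.dupNamespace false

open IsLocalRing

namespace Summit.ResolutionOfSingularities.ResolutionOfSingularities.Theorems.Descent.FieldFibre

/-- (STUB 1 PROVED.) The maximal ideal of `A_𝔮` is extended from `S`. -/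
theorem fibreMaximalIdealExtended : FibreMaximalIdealExtended := by
  intro S R A _ _ _ _ _ _ _ _ _ _ _ hloc hinj 𝔫 _ h𝔫 hfib
  set 𝔮 : Ideal A :=
    𝔫.comap (Algebra.TensorProduct.includeLeftRingHom : A →+* TensorProduct S A R) with h𝔮
  haveI : 𝔮.IsPrime := Ideal.IsPrime.comap _
  have hq : 𝔮.comap (algebraMap S A) = IsLocalRing.maximalIdeal S :=
    comap_eq_maximalIdeal S R A hloc 𝔫 h𝔫
  have hI𝔮 : (IsLocalRing.maximalIdeal S).map (algebraMap S A) ≤ 𝔮 := by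
    rw [Ideal.map_le_iff_le_comap, hq]
  rw [← Localization.AtPrime.map_eq_maximalIdeal, IsScalarTower.algebraMap_eq S A
    (Localization.AtPrime 𝔮), ← Ideal.map_map]
  apply le_antisymm
  · rw [Ideal.map_le_iff_le_comap]
    intro a ha
    obtain ⟨s, hs, hsa⟩ := exists_mul_mem_of_fieldFibre hloc 𝔫 h𝔫 hfib a ha
    have hunit : IsUnit (algebraMap A (Localization.AtPrime 𝔮) s) :=
      IsLocalization.map_units (Localization.AtPrime 𝔮) (⟨s, hs⟩ : 𝔮.primeCompl)
    rw [Ideal.mem_comap, ← Ideal.unit_mul_mem_iff_mem _ hunit, ← map_mul]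
    exact Ideal.mem_map_of_mem _ hsa
  · exact Ideal.map_mono hI𝔮

/-- Zero-dimensional fibre: primes over the maximal ideal are maximal. -/
theorem krullDimLE_zero_fibre (S A : Type) [CommRing S] [IsLocalRing S] [CommRing A]
    [Algebra S A] [Algebra.IsIntegral S A] :
    Ring.KrullDimLE 0 (A ⧸ (IsLocalRing.maximalIdeal S).map (algebraMap S A)) := by
  refine Ring.KrullDimLE.mk₀ fun P hP => ?_
  haveI := hP
  haveI hQp : (P.comap (Ideal.Quotient.mk
      ((IsLocalRing.maximalIdeal S).map (algebraMap S A)))).IsPrime := Ideal.IsPrime.comap _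
  have hQI : (IsLocalRing.maximalIdeal S).map (algebraMap S A) ≤
      P.comap (Ideal.Quotient.mk ((IsLocalRing.maximalIdeal S).map (algebraMap S A))) := by
    intro x hx
    rw [Ideal.mem_comap, Ideal.Quotient.eq_zero_iff_mem.mpr hx]
    exact P.zero_mem
  have hQS : (P.comap (Ideal.Quotient.mk
      ((IsLocalRing.maximalIdeal S).map (algebraMap S A)))).comap (algebraMap S A) =
      IsLocalRing.maximalIdeal S := by
    apply le_antisymm
    · apply IsLocalRing.le_maximalIdeal
      intro htop
      apply hQp.ne_top
      rw [Ideal.eq_top_iff_one] at htop ⊢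
      simpa [Ideal.mem_comap] using htop
    · rw [← Ideal.map_le_iff_le_comap]
      exact hQI
  have hQmax : (P.comap (Ideal.Quotient.mk
      ((IsLocalRing.maximalIdeal S).map (algebraMap S A)))).IsMaximal := by
    apply Ideal.isMaximal_of_isIntegral_of_isMaximal_comap (R := S)
    rw [hQS]
    exact IsLocalRing.maximalIdeal.isMaximal S
  have hPQ : (P.comap (Ideal.Quotient.mk
      ((IsLocalRing.maximalIdeal S).map (algebraMap S A)))).map
      (Ideal.Quotient.mk ((IsLocalRing.maximalIdeal S).map (algebraMap S A))) = P :=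
    Ideal.map_comap_of_surjective _ Ideal.Quotient.mk_surjective _
  rcases Ideal.map_eq_top_or_isMaximal_of_surjective
      (Ideal.Quotient.mk ((IsLocalRing.maximalIdeal S).map (algebraMap S A)))
      Ideal.Quotient.mk_surjective hQmax with h | h
  · exact absurd (hPQ.symm.trans h) hP.ne_top
  · rwa [hPQ] at h

/-- (STUB 2 PROVED.) Going-down height formula + zero-dimensional fibre. -/
theorem dimPreserved : DimPreservedOverMaximal := by
  intro S A _ _ _ _ _ _ _ _ _ hinj 𝔮 _ hq
  haveI : FaithfulSMul S A := (faithfulSMul_iff_algebraMap_injective S A).mpr hinj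
  haveI : Algebra.IsIntegral S A := inferInstance
  haveI : Algebra.HasGoingDown S A := inferInstance
  haveI : IsNoetherianRing A := IsNoetherianRing.of_finite S A
  haveI : 𝔮.LiesOver (IsLocalRing.maximalIdeal S) := ⟨hq.symm⟩
  rw [IsLocalization.AtPrime.ringKrullDim_eq_height 𝔮 (Localization.AtPrime 𝔮),
    ← IsLocalRing.maximalIdeal_height_eq_ringKrullDim,
    Ideal.height_eq_height_add_of_liesOver_of_hasGoingDown (IsLocalRing.maximalIdeal S) 𝔮]
  set I := (IsLocalRing.maximalIdeal S).map (algebraMap S A) with hI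
  have hI𝔮 : I ≤ 𝔮 := by rw [hI, Ideal.map_le_iff_le_comap, hq]
  have hJ : (𝔮.map (Ideal.Quotient.mk I)) ≠ ⊤ := by
    intro htop
    have := congrArg (Ideal.comap (Ideal.Quotient.mk I)) htop
    rw [Ideal.comap_map_of_surjective _ Ideal.Quotient.mk_surjective, Ideal.comap_top] at this
    have hker : Ideal.comap (Ideal.Quotient.mk I) ⊥ = I := by
      rw [← RingHom.ker_eq_comap_bot, Ideal.mk_ker]
    rw [hker, sup_eq_left.mpr hI𝔮] at this
    exact (inferInstance : 𝔮.IsPrime).ne_top this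
  haveI : Nontrivial (A ⧸ I) := Ideal.Quotient.nontrivial_iff.mpr (ne_top_of_le_ne_top
    (inferInstance : 𝔮.IsPrime).ne_top hI𝔮)
  haveI := krullDimLE_zero_fibre S A
  have hdim0 : ringKrullDim (A ⧸ I) = 0 := (ringKrullDimZero_iff_ringKrullDim_eq_zero).mp inferInstance
  have hle := Ideal.height_le_ringKrullDim_of_ne_top hJ
  rw [hdim0] at hle
  have h0 : (𝔮.map (Ideal.Quotient.mk I)).height = 0 := by
    have : ((𝔮.map (Ideal.Quotient.mk I)).height : WithBot ℕ∞) ≤ ((0 : ℕ∞) : WithBot ℕ∞) := by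
      simpa using hle
    exact nonpos_iff_eq_zero.mp (WithBot.coe_le_coe.mp this)
  rw [h0, add_zero]

/-- COMPOSITION: STUB 1 → STUB 2 → P2B. -/
theorem FieldFibreDescendsRegular_of (h1 : FibreMaximalIdealExtended)
    (h2 : DimPreservedOverMaximal) : FieldFibreDescendsRegular := by
  intro S R A _ _ _ _ _ _ _ _ _ _ _ hloc hinj 𝔫 _ h𝔫 hfib
  set 𝔮 : Ideal A :=
    𝔫.comap (Algebra.TensorProduct.includeLeftRingHom : A →+* TensorProduct S A R) with h𝔮
  haveI : 𝔮.IsPrime := Ideal.IsPrime.comap _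
  haveI : IsNoetherianRing A := IsNoetherianRing.of_finite S A
  haveI : IsNoetherianRing (Localization.AtPrime 𝔮) := inferInstance
  have hq : 𝔮.comap (algebraMap S A) = IsLocalRing.maximalIdeal S :=
    comap_eq_maximalIdeal S R A hloc 𝔫 h𝔫
  have hfibre := h1 S R A hloc hinj 𝔫 h𝔫 hfib
  have hdim : ringKrullDim (Localization.AtPrime 𝔮) = ringKrullDim S := h2 S A hinj 𝔮 hq
  apply IsRegularLocalRing.of_spanFinrank_maximalIdeal_le
  rw [hdim, ← IsRegularLocalRing.spanFinrank_maximalIdeal (R := S), hfibre]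
  exact_mod_cast Ideal.spanFinrank_map_le_of_fg _ (IsNoetherian.noetherian _)

/-- **P2B `FieldFibreDescendsRegular` — PROVED** (no sorry). -/
theorem fieldFibreDescendsRegular : FieldFibreDescendsRegular :=
  FieldFibreDescendsRegular_of fibreMaximalIdealExtended dimPreserved

end Summit.ResolutionOfSingularities.ResolutionOfSingularities.Theorems.Descent.FieldFibre
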